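import Summits.CriticalPhenomena.PercolationContinuityZ3.Theorems.Transplant.FKDoubleFanMixedCone
import HarnessLib

/-!
# Double fans, same-apex pairs: invariance of the cone `𝒦*(q)` under `L_M` — part A

Helper file (`--supports stmt-CriticalPhenomena-4575`), FK sub-lane `prim-bschramm-fk-3` (gen 24); builds on p205010 (kernel theorem, internal
audit signed; external expert review pending).  Pure real algebra: no measures, no named facts, no sorries; standard axioms.  Memo
`bschramm/prim-bschramm-fk-3/ALL-SAME-APEX.md` §5–§6 (certificate (I), lab `qcert_D3.pkl`, 243 memberships re-verified by `verify_all.py`).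

(I) `L_{M(a,b)} 𝒦*(q) ⊆ 𝒦*(q)` for all `a, b, q ∈ [0,1]`: for each facet `f` of the cone, `f(L_M κ) = Σ_g C_{f,g}(q,a,b)·g(κ)` over facets `g`, with
`C_{f,g} = Σ_{k,l} B²_k(a) B²_l(b) λ^{kl}_{f,g}(q)` and every `λ` a polynomial with non-negative Bernstein (or power) coefficients — the nine
tensor-Bernstein coefficient operators `T_{kl}(q)` of `(a,b) ↦ L_{M(a,b)}` map the cone into itself.  Each lemma: the identity by `ring`, the sign by
`positivity` and `linarith`.
[folklore]
-/

noncomputable section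

namespace Summit.CriticalPhenomena.PercolationContinuityZ3.Theorems

namespace FK

namespace ThreeApex

/-- (I) the facet `phi1` of `L_M κ` is `≥ 0` for `κ ∈ 𝒦*(q)`, `q, a, b ∈ [0,1]` (tensor-Bernstein certificate). [folklore] -/
theorem InKstar.lm_phi1 {q a b : ℝ} (hq0 : 0 ≤ q) (hq1 : q ≤ 1) (ha0 : 0 ≤ a) (ha1 : a ≤ 1) (hb0 : 0 ≤ b) (hb1 : b ≤ 1) {κ : K7}
    (hκ : InKstar q κ) : 0 ≤ -(LM q a b κ).k := by
  have hq' : 0 ≤ 1 - q := sub_nonneg.2 hq1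
  have ha' : 0 ≤ 1 - a := sub_nonneg.2 ha1
  have hb' : 0 ≤ 1 - b := sub_nonneg.2 hb1
  have e : -(LM q a b κ).k =
      (2 * (a * (1 - a)) * (1 - b) ^ 2 + (3 * q) * (a * (1 - a)) * (b * (1 - b)) + (q ^ 3) * (a * (1 - a)) * b ^ 2 + 2 * a ^ 2 * (1 - b) ^ 2 + (3 * q) * a ^ 2 * (b * (1 - b)) + (q ^ 3) * a ^ 2 * b ^ 2) * (-κ.k)
      + ((6 * (1 - q) ^ 3 + 15 * q * (1 - q) ^ 2 + 12 * q ^ 2 * (1 - q) + 3 * q ^ 3) * (a * (1 - a)) * (b * (1 - b)) + (2 * (1 - q) ^ 3 + 7 * q * (1 - q) ^ 2 + 9 * q ^ 2 * (1 - q) + 3 * q ^ 3) * (a * (1 - a)) * b ^ 2 + (4 * (1 - q) ^ 3 + 10 * q * (1 - q) ^ 2 + 8 * q ^ 2 * (1 - q) + 2 * q ^ 3) * a ^ 2 * (b * (1 - b)) + (2 * q * (1 - q) ^ 2 + 5 * q ^ 2 * (1 - q) + 2 * q ^ 3) * a ^ 2 * b ^ 2) * (-κ.bU)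
      + ((2 * (1 - q) ^ 3 + 4 * q * (1 - q) ^ 2 + 2 * q ^ 2 * (1 - q)) * (a * (1 - a)) * (b * (1 - b)) + (1 * q * (1 - q) ^ 2 + 2 * q ^ 2 * (1 - q)) * (a * (1 - a)) * b ^ 2 + (2 * (1 - q) ^ 3 + 4 * q * (1 - q) ^ 2 + 2 * q ^ 2 * (1 - q)) * a ^ 2 * (b * (1 - b)) + (1 * q * (1 - q) ^ 2 + 2 * q ^ 2 * (1 - q)) * a ^ 2 * b ^ 2) * (κ.aX)
      + ((1/2) * (1 - a) ^ 2 * (b * (1 - b)) + (1/2) * (1 - a) ^ 2 * b ^ 2 + 2 * (a * (1 - a)) * (b * (1 - b)) + (1 + (1/2) * q + (1/2) * q ^ 2) * (a * (1 - a)) * b ^ 2 + a ^ 2 * (b * (1 - b)) + ((1/2) * q + (1/2) * q ^ 2) * a ^ 2 * b ^ 2) * (-(2 - q) * κ.k - (1 - q) * κ.aX + (2 - q) * κ.bU + κ.bY)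
      + ((1/2) * (1 - a) ^ 2 * (b * (1 - b)) + (1/2) * (1 - a) ^ 2 * b ^ 2 + (1 * (1 - q) ^ 3 + (5/2) * q * (1 - q) ^ 2 + (3/2) * q ^ 2 * (1 - q)) * (a * (1 - a)) * b ^ 2 + (1 * (1 - q) ^ 3 + (5/2) * q * (1 - q) ^ 2 + (3/2) * q ^ 2 * (1 - q)) * a ^ 2 * b ^ 2) * (-q * κ.k + (1 - q) * κ.aX - (2 - q) * κ.bU + κ.bY) := by
    simp only [LM]; ring
  rw [e]
  have t0 : 0 ≤ (2 * (a * (1 - a)) * (1 - b) ^ 2 + (3 * q) * (a * (1 - a)) * (b * (1 - b)) + (q ^ 3) * (a * (1 - a)) * b ^ 2 + 2 * a ^ 2 * (1 - b) ^ 2 + (3 * q) * a ^ 2 * (b * (1 - b)) + (q ^ 3) * a ^ 2 * b ^ 2) * (-κ.k) := mul_nonneg (by positivity) hκ.phi1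
  have t1 : 0 ≤ ((6 * (1 - q) ^ 3 + 15 * q * (1 - q) ^ 2 + 12 * q ^ 2 * (1 - q) + 3 * q ^ 3) * (a * (1 - a)) * (b * (1 - b)) + (2 * (1 - q) ^ 3 + 7 * q * (1 - q) ^ 2 + 9 * q ^ 2 * (1 - q) + 3 * q ^ 3) * (a * (1 - a)) * b ^ 2 + (4 * (1 - q) ^ 3 + 10 * q * (1 - q) ^ 2 + 8 * q ^ 2 * (1 - q) + 2 * q ^ 3) * a ^ 2 * (b * (1 - b)) + (2 * q * (1 - q) ^ 2 + 5 * q ^ 2 * (1 - q) + 2 * q ^ 3) * a ^ 2 * b ^ 2) * (-κ.bU) := mul_nonneg (by positivity) hκ.phi2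
  have t2 : 0 ≤ ((2 * (1 - q) ^ 3 + 4 * q * (1 - q) ^ 2 + 2 * q ^ 2 * (1 - q)) * (a * (1 - a)) * (b * (1 - b)) + (1 * q * (1 - q) ^ 2 + 2 * q ^ 2 * (1 - q)) * (a * (1 - a)) * b ^ 2 + (2 * (1 - q) ^ 3 + 4 * q * (1 - q) ^ 2 + 2 * q ^ 2 * (1 - q)) * a ^ 2 * (b * (1 - b)) + (1 * q * (1 - q) ^ 2 + 2 * q ^ 2 * (1 - q)) * a ^ 2 * b ^ 2) * (κ.aX) := mul_nonneg (by positivity) hκ.phi3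
  have t3 : 0 ≤ ((1/2) * (1 - a) ^ 2 * (b * (1 - b)) + (1/2) * (1 - a) ^ 2 * b ^ 2 + 2 * (a * (1 - a)) * (b * (1 - b)) + (1 + (1/2) * q + (1/2) * q ^ 2) * (a * (1 - a)) * b ^ 2 + a ^ 2 * (b * (1 - b)) + ((1/2) * q + (1/2) * q ^ 2) * a ^ 2 * b ^ 2) * (-(2 - q) * κ.k - (1 - q) * κ.aX + (2 - q) * κ.bU + κ.bY) := mul_nonneg (by positivity) hκ.phi7
  have t4 : 0 ≤ ((1/2) * (1 - a) ^ 2 * (b * (1 - b)) + (1/2) * (1 - a) ^ 2 * b ^ 2 + (1 * (1 - q) ^ 3 + (5/2) * q * (1 - q) ^ 2 + (3/2) * q ^ 2 * (1 - q)) * (a * (1 - a)) * b ^ 2 + (1 * (1 - q) ^ 3 + (5/2) * q * (1 - q) ^ 2 + (3/2) * q ^ 2 * (1 - q)) * a ^ 2 * b ^ 2) * (-q * κ.k + (1 - q) * κ.aX - (2 - q) * κ.bU + κ.bY) := mul_nonneg (by positivity) hκ.phi11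
  linarith

/-- (I) the facet `phi2` of `L_M κ` is `≥ 0` for `κ ∈ 𝒦*(q)`, `q, a, b ∈ [0,1]` (tensor-Bernstein certificate). [folklore] -/
theorem InKstar.lm_phi2 {q a b : ℝ} (hq0 : 0 ≤ q) (hq1 : q ≤ 1) (ha0 : 0 ≤ a) (ha1 : a ≤ 1) (hb0 : 0 ≤ b) (hb1 : b ≤ 1) {κ : K7}
    (hκ : InKstar q κ) : 0 ≤ -(LM q a b κ).bU := by
  have hq' : 0 ≤ 1 - q := sub_nonneg.2 hq1
  have ha' : 0 ≤ 1 - a := sub_nonneg.2 ha1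
  have hb' : 0 ≤ 1 - b := sub_nonneg.2 hb1
  have e : -(LM q a b κ).bU =
      ((a * (1 - a)) * (1 - b) ^ 2 + (a * (1 - a)) * (b * (1 - b)) + a ^ 2 * (1 - b) ^ 2 + q * a ^ 2 * (b * (1 - b))) * (-κ.k)
      + ((a * (1 - a)) * (b * (1 - b)) + (a * (1 - a)) * b ^ 2 + a ^ 2 * (b * (1 - b)) + q * a ^ 2 * b ^ 2) * (-κ.bU)
      + ((1 * (1 - q) ^ 3 + 2 * q * (1 - q) ^ 2 + 1 * q ^ 2 * (1 - q)) * a ^ 2 * (b * (1 - b))) * (κ.aX) := by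
    simp only [LM]; ring
  rw [e]
  have t0 : 0 ≤ ((a * (1 - a)) * (1 - b) ^ 2 + (a * (1 - a)) * (b * (1 - b)) + a ^ 2 * (1 - b) ^ 2 + q * a ^ 2 * (b * (1 - b))) * (-κ.k) := mul_nonneg (by positivity) hκ.phi1
  have t1 : 0 ≤ ((a * (1 - a)) * (b * (1 - b)) + (a * (1 - a)) * b ^ 2 + a ^ 2 * (b * (1 - b)) + q * a ^ 2 * b ^ 2) * (-κ.bU) := mul_nonneg (by positivity) hκ.phi2
  have t2 : 0 ≤ ((1 * (1 - q) ^ 3 + 2 * q * (1 - q) ^ 2 + 1 * q ^ 2 * (1 - q)) * a ^ 2 * (b * (1 - b))) * (κ.aX) := mul_nonneg (by positivity) hκ.phi3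
  linarith

/-- (I) the facet `phi3` of `L_M κ` is `≥ 0` for `κ ∈ 𝒦*(q)`, `q, a, b ∈ [0,1]` (tensor-Bernstein certificate). [folklore] -/
theorem InKstar.lm_phi3 {q a b : ℝ} (hq0 : 0 ≤ q) (hq1 : q ≤ 1) (ha0 : 0 ≤ a) (ha1 : a ≤ 1) (hb0 : 0 ≤ b) (hb1 : b ≤ 1) {κ : K7}
    (hκ : InKstar q κ) : 0 ≤ (LM q a b κ).aX := by
  have hq' : 0 ≤ 1 - q := sub_nonneg.2 hq1
  have ha' : 0 ≤ 1 - a := sub_nonneg.2 ha1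
  have hb' : 0 ≤ 1 - b := sub_nonneg.2 hb1
  have e : (LM q a b κ).aX =
      ((a * (1 - a)) * (1 - b) ^ 2 + (q ^ 3) * (a * (1 - a)) * (b * (1 - b)) + a ^ 2 * (1 - b) ^ 2) * (-κ.k)
      + ((2 * (1 - q) ^ 3 + 7 * q * (1 - q) ^ 2 + 9 * q ^ 2 * (1 - q) + 3 * q ^ 3) * (a * (1 - a)) * (b * (1 - b))) * (-κ.bU)
      + ((1 * q * (1 - q) ^ 2 + 2 * q ^ 2 * (1 - q)) * (a * (1 - a)) * (b * (1 - b)) + q * (a * (1 - a)) * b ^ 2 + q * a ^ 2 * (b * (1 - b)) + q * a ^ 2 * b ^ 2) * (κ.aX)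
      + ((1/2) * (1 - a) ^ 2 * (b * (1 - b)) + (1/2) * (1 - a) ^ 2 * b ^ 2 + (1 + (1/2) * q + (1/2) * q ^ 2) * (a * (1 - a)) * (b * (1 - b))) * (-(2 - q) * κ.k - (1 - q) * κ.aX + (2 - q) * κ.bU + κ.bY)
      + ((1/2) * (1 - a) ^ 2 * (b * (1 - b)) + (1/2) * (1 - a) ^ 2 * b ^ 2 + (1 * (1 - q) ^ 3 + (5/2) * q * (1 - q) ^ 2 + (3/2) * q ^ 2 * (1 - q)) * (a * (1 - a)) * (b * (1 - b)) + (a * (1 - a)) * b ^ 2 + a ^ 2 * (b * (1 - b))) * (-q * κ.k + (1 - q) * κ.aX - (2 - q) * κ.bU + κ.bY) := by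
    simp only [LM]; ring
  rw [e]
  have t0 : 0 ≤ ((a * (1 - a)) * (1 - b) ^ 2 + (q ^ 3) * (a * (1 - a)) * (b * (1 - b)) + a ^ 2 * (1 - b) ^ 2) * (-κ.k) := mul_nonneg (by positivity) hκ.phi1
  have t1 : 0 ≤ ((2 * (1 - q) ^ 3 + 7 * q * (1 - q) ^ 2 + 9 * q ^ 2 * (1 - q) + 3 * q ^ 3) * (a * (1 - a)) * (b * (1 - b))) * (-κ.bU) := mul_nonneg (by positivity) hκ.phi2
  have t2 : 0 ≤ ((1 * q * (1 - q) ^ 2 + 2 * q ^ 2 * (1 - q)) * (a * (1 - a)) * (b * (1 - b)) + q * (a * (1 - a)) * b ^ 2 + q * a ^ 2 * (b * (1 - b)) + q * a ^ 2 * b ^ 2) * (κ.aX) := mul_nonneg (by positivity) hκ.phi3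
  have t3 : 0 ≤ ((1/2) * (1 - a) ^ 2 * (b * (1 - b)) + (1/2) * (1 - a) ^ 2 * b ^ 2 + (1 + (1/2) * q + (1/2) * q ^ 2) * (a * (1 - a)) * (b * (1 - b))) * (-(2 - q) * κ.k - (1 - q) * κ.aX + (2 - q) * κ.bU + κ.bY) := mul_nonneg (by positivity) hκ.phi7
  have t4 : 0 ≤ ((1/2) * (1 - a) ^ 2 * (b * (1 - b)) + (1/2) * (1 - a) ^ 2 * b ^ 2 + (1 * (1 - q) ^ 3 + (5/2) * q * (1 - q) ^ 2 + (3/2) * q ^ 2 * (1 - q)) * (a * (1 - a)) * (b * (1 - b)) + (a * (1 - a)) * b ^ 2 + a ^ 2 * (b * (1 - b))) * (-q * κ.k + (1 - q) * κ.aX - (2 - q) * κ.bU + κ.bY) := mul_nonneg (by positivity) hκ.phi11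
  linarith

/-- (I) the facet `phi4` of `L_M κ` is `≥ 0` for `κ ∈ 𝒦*(q)`, `q, a, b ∈ [0,1]` (tensor-Bernstein certificate). [folklore] -/
theorem InKstar.lm_phi4 {q a b : ℝ} (hq0 : 0 ≤ q) (hq1 : q ≤ 1) (ha0 : 0 ≤ a) (ha1 : a ≤ 1) (hb0 : 0 ≤ b) (hb1 : b ≤ 1) {κ : K7}
    (hκ : InKstar q κ) : 0 ≤ -(LM q a b κ).aU := by
  have hq' : 0 ≤ 1 - q := sub_nonneg.2 hq1
  have ha' : 0 ≤ 1 - a := sub_nonneg.2 ha1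
  have hb' : 0 ≤ 1 - b := sub_nonneg.2 hb1
  have e : -(LM q a b κ).aU =
      ((2 * (1 - q) ^ 3 + 5 * q * (1 - q) ^ 2 + 4 * q ^ 2 * (1 - q) + 1 * q ^ 3) * (a * (1 - a)) * (b * (1 - b)) + (a * (1 - a)) * b ^ 2 + a ^ 2 * (b * (1 - b)) + q * a ^ 2 * b ^ 2) * (-κ.aU)
      + ((a * (1 - a)) * (b * (1 - b)) + a ^ 2 * (b * (1 - b))) * ((2 - q) * κ.aU - κ.aY) := by
    simp only [LM]; ring
  rw [e]
  have t0 : 0 ≤ ((2 * (1 - q) ^ 3 + 5 * q * (1 - q) ^ 2 + 4 * q ^ 2 * (1 - q) + 1 * q ^ 3) * (a * (1 - a)) * (b * (1 - b)) + (a * (1 - a)) * b ^ 2 + a ^ 2 * (b * (1 - b)) + q * a ^ 2 * b ^ 2) * (-κ.aU) := mul_nonneg (by positivity) hκ.phi4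
  have t1 : 0 ≤ ((a * (1 - a)) * (b * (1 - b)) + a ^ 2 * (b * (1 - b))) * ((2 - q) * κ.aU - κ.aY) := mul_nonneg (by positivity) hκ.phi5
  linarith

/-- (I) the facet `phi5` of `L_M κ` is `≥ 0` for `κ ∈ 𝒦*(q)`, `q, a, b ∈ [0,1]` (tensor-Bernstein certificate). [folklore] -/
theorem InKstar.lm_phi5 {q a b : ℝ} (hq0 : 0 ≤ q) (hq1 : q ≤ 1) (ha0 : 0 ≤ a) (ha1 : a ≤ 1) (hb0 : 0 ≤ b) (hb1 : b ≤ 1) {κ : K7}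
    (hκ : InKstar q κ) : 0 ≤ (2 - q) * (LM q a b κ).aU - (LM q a b κ).aY := by
  have hq' : 0 ≤ 1 - q := sub_nonneg.2 hq1
  have ha' : 0 ≤ 1 - a := sub_nonneg.2 ha1
  have hb' : 0 ≤ 1 - b := sub_nonneg.2 hb1
  have e : (2 - q) * (LM q a b κ).aU - (LM q a b κ).aY =
      ((2 * q * (1 - q) ^ 2 + 3 * q ^ 2 * (1 - q) + 1 * q ^ 3) * (a * (1 - a)) * (b * (1 - b)) + (2 * q * (1 - q) ^ 2 + 3 * q ^ 2 * (1 - q) + 1 * q ^ 3) * (a * (1 - a)) * b ^ 2) * (-κ.aU)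
      + (q * (a * (1 - a)) * (b * (1 - b)) + q * (a * (1 - a)) * b ^ 2 + q * a ^ 2 * (b * (1 - b)) + q * a ^ 2 * b ^ 2) * ((2 - q) * κ.aU - κ.aY) := by
    simp only [LM]; ring
  rw [e]
  have t0 : 0 ≤ ((2 * q * (1 - q) ^ 2 + 3 * q ^ 2 * (1 - q) + 1 * q ^ 3) * (a * (1 - a)) * (b * (1 - b)) + (2 * q * (1 - q) ^ 2 + 3 * q ^ 2 * (1 - q) + 1 * q ^ 3) * (a * (1 - a)) * b ^ 2) * (-κ.aU) := mul_nonneg (by positivity) hκ.phi4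
  have t1 : 0 ≤ (q * (a * (1 - a)) * (b * (1 - b)) + q * (a * (1 - a)) * b ^ 2 + q * a ^ 2 * (b * (1 - b)) + q * a ^ 2 * b ^ 2) * ((2 - q) * κ.aU - κ.aY) := mul_nonneg (by positivity) hκ.phi5
  linarith

/-- (I) the facet `phi6` of `L_M κ` is `≥ 0` for `κ ∈ 𝒦*(q)`, `q, a, b ∈ [0,1]` (tensor-Bernstein certificate). [folklore] -/
theorem InKstar.lm_phi6 {q a b : ℝ} (hq0 : 0 ≤ q) (hq1 : q ≤ 1) (ha0 : 0 ≤ a) (ha1 : a ≤ 1) (hb0 : 0 ≤ b) (hb1 : b ≤ 1) {κ : K7}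
    (hκ : InKstar q κ) : 0 ≤ (LM q a b κ).bX := by
  have hq' : 0 ≤ 1 - q := sub_nonneg.2 hq1
  have ha' : 0 ≤ 1 - a := sub_nonneg.2 ha1
  have hb' : 0 ≤ 1 - b := sub_nonneg.2 hb1
  have e : (LM q a b κ).bX =
      (q * (a * (1 - a)) * (b * (1 - b)) + q * (a * (1 - a)) * b ^ 2 + q * a ^ 2 * (b * (1 - b)) + q * a ^ 2 * b ^ 2) * (κ.bX) := by
    simp only [LM]; ring
  rw [e]
  have t0 : 0 ≤ (q * (a * (1 - a)) * (b * (1 - b)) + q * (a * (1 - a)) * b ^ 2 + q * a ^ 2 * (b * (1 - b)) + q * a ^ 2 * b ^ 2) * (κ.bX) := mul_nonneg (by positivity) hκ.phi6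
  linarith


end ThreeApex

end FK

end Summit.CriticalPhenomena.PercolationContinuityZ3.Theorems
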